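import Summits.KontsevichZagierPeriods.Zeta5Search.Certificates.RayC1KernelClassLowKind
import Summits.KontsevichZagierPeriods.Zeta5Search.RayC1LettersTA01R1
import HarnessLib

/-!
# ζ(5) search — certificates: CLASS-LAW WINDOWS BELOW θ = 1 of the ray RayC1 as `CWin`s, consumption round R4, part P0 (TYPER g17)

HONEST FRAMING: systematic search; no irrationality claim unless certified.  `p`-adic bookkeeping; nothing about `ζ(5)`.

OUR work (Summit side; typer seat, generation 17; generator `HOME/pub-zeta5-typer-g17/gen/gen_classround.py C1 … R4`).  PROVED class-law /
atlas windows of this ray (tree theorems BY NAME) as `CWin` records with short adapters to the normal form `CWin.HoldsLow`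
(bridge `bC1_bridge : bRay β n = bC1 n`); landed chunks of earlier rounds are reused by the round's list file, this part holds only
NEW windows: `TA01_window`.
-/

noncomputable section

namespace Summit.KontsevichZagierPeriods.Zeta5Search.RayC1

open Summit.KontsevichZagierPeriods.Zeta5Search.RayKernel
open Summit.KontsevichZagierPeriods.Zeta5Search.CasoratianValuation (casoratian)
open Summit.KontsevichZagierPeriods.Zeta5Search.T1Rays (bRay)

/-- New class-law windows of round R4 (below θ = 1), chunk 0: `⟨a₁, a₂, b₁, b₂, N₀, B⟩`. -/
def c1CWLR4_0 : List CWin :=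
  [⟨64, 65, 65, 66, 1362, -262⟩]

/-- `TA01_window` (`θ ∈ (64/65, 65/66]`, `B = -262`; tree theorem `TA01.window`) in the LOW normal form `CWin.HoldsLow`. -/
theorem cwl_TA01_window : (⟨64, 65, 65, 66, 1362, -262⟩ : CWin).HoldsLow := by
  intro n p hn hp h1 h2 hnd hne
  dsimp only at hn h1 h2 ⊢
  have h4p : n < 4 * p := by omega
  have hsq0 : n * n < (4 * p) * (4 * p) := Nat.mul_lt_mul'' h4p h4p
  have hnn : 1362 * n ≤ n * n := Nat.mul_le_mul_right n (by omega)
  have hsq : 85 * n + 2 < p ^ 2 := by rw [pow_two]; nlinarith [hsq0, hnn]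
  have h2' : 66 * p < 65 * n := by
    rcases h2.lt_or_eq with h | h
    · exact h
    · exfalso
      have hdvd : p ∣ 65 * n := ⟨66, by linarith [h]⟩
      rcases (Nat.Prime.dvd_mul hp).1 hdvd with h3 | h3
      · exact absurd (Nat.le_of_dvd (by norm_num) h3) (by omega)
      · exact hnd h3
  have h := Summit.KontsevichZagierPeriods.Zeta5Search.RayC1Letters.TA01.window n p (by omega) hp (by omega) h2' hsq (by rw [bC1_bridge]; exact hne)
  rw [bC1_bridge] at h
  exact h

/-- Every window of this chunk holds. -/
theorem c1CWLR4_0_holdsLow : ∀ c ∈ c1CWLR4_0, c.HoldsLow := by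
  intro c hc
  simp only [c1CWLR4_0, List.mem_cons, List.mem_nil_iff, or_false] at hc
  subst hc
  exact cwl_TA01_window

end Summit.KontsevichZagierPeriods.Zeta5Search.RayC1
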